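import Mathlib.Analysis.ODE.Gronwall
import Mathlib.Analysis.Calculus.ContDiff.RCLike
import Mathlib.Analysis.Calculus.InverseFunctionTheorem.Deriv
import Summits.SmoothPoincare4.SmoothPoincare4.Theorems.DottedCircleRasmussenDcrGapHelperFriendsCarrierVkAdaptedField

/-!
# Helper `helper_friendsCarrier_Vk_discFlowLinesNeat` (piece 8 of the registered helper `helper_friendsCarrier_Vk`,
stub `stub_friendsCarrier`, line `mk_friends`, skeleton v5) for crux `DcrGap`
(item stmt-SmoothPoincare4-16128, route route-SmoothPoincare4-DottedCircleRasmussen)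

**In the collar of the neat-adapted field the slice disc is a product, parametrised by level.**
Companion of `helper_friendsCarrier_Vk_discFlowLines` for the field of
`helper_friendsCarrier_Vk_adaptedFieldNeat`: let `f₁` be a NEAT model slice disc of the model knot
`K₁` (`d/dρ G_k(f₁(ρ t))|₁ < 0`), `V` a `C^∞` field on `ℝ⁴` vanishing outside a ball with
`V(f₁(t u)) = (d(G_k ∘ f₁)(t u) u)⁻¹ • df₁(t u) u` for `|t - 1| < δ'`, and `Φ` any flow of `V`.  Then
for `|s| < δ''` the flow line from `K₁ u = f₁ u` is on the disc ray through `u`, at level `1 + s`: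

  `Φ(s, K₁ u) = f₁(r u)` with `|r - 1| < δ'` and `G_k(f₁(r u)) = 1 + s`.

Proof: near the circle `h_u(r) = G_k(f₁(r u))` has derivative `d(G_k ∘ f₁)(r u) u < 0` (neatness and
continuity), so it is a `C^∞` diffeomorphism of an interval onto an open interval around `1` (inverse
function theorem in one variable, `HasStrictDerivAt.to_local_left_inverse`), uniformly in `u`
(compactness: `h_u' ≤ -μ₀ < 0`, mean value inequality); the curve `σ ↦ f₁(h_u⁻¹(1 + σ) u)` is an integral
curve of `V` from `f₁ u` (chain rule and the tangency), hence equals the flow line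
(`ODE_solution_unique_of_mem_Ioo`; `V` is Lipschitz, being `C¹` with compact support).

No definitions, no named facts, no `sorry`.

## References

* P. Hartman, *Ordinary Differential Equations* (1964), Ch. II Thm. 1.1. [folklore]
* J. Milnor, *Morse theory* (1963), Thm. 3.1. [Milnor1963]
-/

-- the prescribed namespace `Summit.<P>.<Sub>.…` duplicates `SmoothPoincare4` (P = Sub)
set_option linter.dupNamespace false
set_option linter.style.longLine false

noncomputable section

open scoped Manifold ContDiff Topology NNReal
open Set Function Metric Filter
open Literature.Topology.FourManifolds Literature.Topology.FourManifolds.MMSW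

namespace Summit.SmoothPoincare4.SmoothPoincare4.Theorems.DcrGap.MkFriends

namespace FriendsCarrierVk

/-- **The neat zone.**  For a neat model slice disc of a model knot there is `δ₂ ∈ (0, 1/2]` such that
for `|‖x‖ - 1| < δ₂` the point `f₁ x` is off the poles (`|z - c_j|² > 1/2`) and the radial clock
`d(G_k ∘ f₁)(x)(x/‖x‖)` is negative. [folklore] -/
theorem exists_neatZone (k : ℕ) {K₁ : (sphere (0 : EuclideanSpace ℝ (Fin 2)) 1) → EuclideanSpace ℝ (Fin 4)}
    {f₁ : EuclideanSpace ℝ (Fin 2) → EuclideanSpace ℝ (Fin 4)}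
    (hK : IsModelKnot k K₁) (hf : IsModelSliceDisc k K₁ f₁)
    (hneat : ∀ t : sphere (0 : EuclideanSpace ℝ (Fin 2)) 1,
      deriv (fun ρ : ℝ => levelFun k (f₁ (ρ • (t : EuclideanSpace ℝ (Fin 2))))) 1 < 0) :
    ∃ δ₂ : ℝ, 0 < δ₂ ∧ δ₂ ≤ 1 / 2 ∧ ∀ x : EuclideanSpace ℝ (Fin 2), |‖x‖ - 1| < δ₂ →
      (∀ j, (1 : ℝ) / 2 < holeTerm k j (f₁ x)) ∧
        fderiv ℝ (fun y => levelFun k (f₁ y)) x (‖x‖⁻¹ • x) < 0 := by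
  have hfs : ContDiff ℝ ∞ f₁ := contMDiff_iff_contDiff.1 hf.1
  set Gf : EuclideanSpace ℝ (Fin 2) → ℝ := fun y => levelFun k (f₁ y) with hGf
  set A : Set (EuclideanSpace ℝ (Fin 2)) := {x | ∀ j : Fin k, (1 : ℝ) / 2 < holeTerm k j (f₁ x)} with hAdef
  have hA : IsOpen A := (isOpen_guard (r := k) (1 / 2)).preimage hfs.continuous
  have hGfA : ContDiffOn ℝ ∞ Gf A := fun x hx =>
    ((contDiffAt_levelFun fun j => (lt_trans (by norm_num) (hx j)).ne').comp x hfs.contDiffAt).contDiffWithinAt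
  have hsphA : ∀ x ∈ sphere (0 : EuclideanSpace ℝ (Fin 2)) 1, x ∈ A := by
    intro x hx j
    have h1 : f₁ x = K₁ ⟨x, hx⟩ := hf.apply_sphere ⟨x, hx⟩
    show (1 : ℝ) / 2 < holeTerm k j (f₁ x)
    rw [h1]
    exact lt_of_lt_of_le (by norm_num) ((hK.mem ⟨x, hx⟩).1 j)
  set A' : Set (EuclideanSpace ℝ (Fin 2)) := (A ∩ {x | x ≠ 0}) ∩ (fun x => fderiv ℝ Gf x (‖x‖⁻¹ • x)) ⁻¹' Iio 0 with hA'
  have hA'o : IsOpen A' := by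
    have hc : ContinuousOn (fun x => fderiv ℝ Gf x (‖x‖⁻¹ • x)) (A ∩ {x | x ≠ 0}) := by
      intro x hx
      have h1 : ContinuousAt (fun x => fderiv ℝ Gf x) x :=
        ((hGfA.continuousOn_fderiv_of_isOpen hA (by simp)).continuousAt (hA.mem_nhds hx.1))
      have h2 : ContinuousAt (fun x : EuclideanSpace ℝ (Fin 2) => ‖x‖⁻¹ • x) x :=
        ((continuous_norm.continuousAt.inv₀ (norm_ne_zero_iff.2 hx.2)).smul continuousAt_id)
      exact (h1.clm_apply h2).continuousWithinAt
    exact hc.isOpen_inter_preimage (hA.inter (isOpen_ne.preimage continuous_id)) isOpen_Iio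
  have hsub : sphere (0 : EuclideanSpace ℝ (Fin 2)) 1 ⊆ A' := by
    intro x hx
    have hxA := hsphA x hx
    have hx1 : ‖x‖ = 1 := by simpa using hx
    have hx0 : x ≠ 0 := by intro h; rw [h, norm_zero] at hx1; exact zero_ne_one hx1
    refine ⟨⟨hxA, hx0⟩, ?_⟩
    show fderiv ℝ Gf x (‖x‖⁻¹ • x) < 0
    have hline : HasDerivAt (fun ρ : ℝ => ρ • x) x 1 := by simpa using (hasDerivAt_id (1 : ℝ)).smul_const x
    have hd : HasDerivAt (fun ρ : ℝ => Gf (ρ • x)) (fderiv ℝ Gf x x) 1 :=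
      ((hGfA.contDiffAt (hA.mem_nhds hxA)).differentiableAt (by simp)).hasFDerivAt.comp_hasDerivAt_of_eq 1 hline
        (by simp)
    rw [hx1, inv_one, one_smul, ← hd.deriv]
    exact hneat ⟨x, hx⟩
  obtain ⟨ε₀, hε₀, hth⟩ := (isCompact_sphere (0 : EuclideanSpace ℝ (Fin 2)) 1).exists_thickening_subset_open hA'o hsub
  refine ⟨min ε₀ (1 / 2), by positivity, min_le_right _ _, fun x hx => ?_⟩
  have hε1 : min ε₀ (1 / 2) ≤ 1 := (min_le_right _ _).trans (by norm_num)
  have : thickening (min ε₀ (1 / 2)) (sphere (0 : EuclideanSpace ℝ (Fin 2)) 1) ⊆ thickening ε₀ (sphere 0 1) :=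
    thickening_mono (min_le_left _ _) _
  obtain ⟨⟨hxA, -⟩, hneg⟩ := hth (this (mem_thickening_sphere hε1 hx))
  exact ⟨hxA, hneg⟩

set_option maxHeartbeats 800000 in
/-- **The disc rays, parametrised by level, are the flow lines of the neat-adapted field** (uniqueness of
integral curves and the one-variable inverse function theorem, uniformly along the circle). [folklore] -/
theorem flow_eq_disc_ray_neat (k : ℕ) {K₁ : (sphere (0 : EuclideanSpace ℝ (Fin 2)) 1) → EuclideanSpace ℝ (Fin 4)}
    {f₁ : EuclideanSpace ℝ (Fin 2) → EuclideanSpace ℝ (Fin 4)}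
    {V : EuclideanSpace ℝ (Fin 4) → EuclideanSpace ℝ (Fin 4)} {Φ : ℝ × EuclideanSpace ℝ (Fin 4) → EuclideanSpace ℝ (Fin 4)}
    {R δ' : ℝ} (hK : IsModelKnot k K₁) (hf : IsModelSliceDisc k K₁ f₁)
    (hneat : ∀ t : sphere (0 : EuclideanSpace ℝ (Fin 2)) 1,
      deriv (fun ρ : ℝ => levelFun k (f₁ (ρ • (t : EuclideanSpace ℝ (Fin 2))))) 1 < 0)
    (hV : ContDiff ℝ ∞ V) (hVR : ∀ y, R ≤ ‖y‖ → V y = 0) (hδ' : 0 < δ')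
    (htan : ∀ (u : sphere (0 : EuclideanSpace ℝ (Fin 2)) 1) (t : ℝ), 1 - δ' < t → t < 1 + δ' →
      V (f₁ (t • (u : EuclideanSpace ℝ (Fin 2)))) =
        (fderiv ℝ (fun y => levelFun k (f₁ y)) (t • (u : EuclideanSpace ℝ (Fin 2))) (u : EuclideanSpace ℝ (Fin 2)))⁻¹ •
          fderiv ℝ f₁ (t • (u : EuclideanSpace ℝ (Fin 2))) (u : EuclideanSpace ℝ (Fin 2)))
    (hΦ : ∀ x s, HasDerivAt (fun s : ℝ => Φ (s, x)) (V (Φ (s, x))) s) (hΦ0 : ∀ x, Φ (0, x) = x) :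
    ∃ δ'' : ℝ, 0 < δ'' ∧ ∀ (u : sphere (0 : EuclideanSpace ℝ (Fin 2)) 1) (s : ℝ), |s| < δ'' →
      ∃ r : ℝ, |r - 1| < δ' ∧ Φ (s, f₁ (u : EuclideanSpace ℝ (Fin 2))) = f₁ (r • (u : EuclideanSpace ℝ (Fin 2))) ∧
        levelFun k (f₁ (r • (u : EuclideanSpace ℝ (Fin 2)))) = 1 + s := by
  have hfs : ContDiff ℝ ∞ f₁ := contMDiff_iff_contDiff.1 hf.1
  set Gf : EuclideanSpace ℝ (Fin 2) → ℝ := fun y => levelFun k (f₁ y) with hGf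
  -- the neat zone and the smoothness of `G ∘ f₁` there
  obtain ⟨δ₂, hδ₂, hδ₂half, hzone⟩ := exists_neatZone k hK hf hneat
  set δ₃ : ℝ := min δ₂ δ' with hδ₃
  have hδ₃pos : 0 < δ₃ := lt_min hδ₂ hδ'
  have hδ₃₂ : δ₃ ≤ δ₂ := min_le_left _ _
  have hδ₃' : δ₃ ≤ δ' := min_le_right _ _
  have hδ₃1 : δ₃ ≤ 1 / 2 := hδ₃₂.trans hδ₂half
  have hδ₃₂' : δ₃ / 2 < δ₂ := (half_lt_self hδ₃pos).trans_le hδ₃₂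
  have hGfat : ∀ x : EuclideanSpace ℝ (Fin 2), |‖x‖ - 1| < δ₂ → ContDiffAt ℝ ∞ Gf x := fun x hx =>
    (contDiffAt_levelFun fun j => (lt_trans (by norm_num) ((hzone x hx).1 j)).ne').comp x hfs.contDiffAt
  -- `V` is Lipschitz
  have hsupp : HasCompactSupport V := by
    refine HasCompactSupport.intro (isCompact_closedBall (0 : EuclideanSpace ℝ (Fin 4)) R) fun y hy => hVR y ?_
    rw [mem_closedBall, dist_zero_right, not_le] at hy
    exact hy.le
  obtain ⟨C, hC⟩ := hV.lipschitzWith_of_hasCompactSupport hsupp (by simp)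
  -- the radial clock `μ x = d(G ∘ f₁)(x)(x/‖x‖)` and a uniform negative bound on a compact annulus
  set μ : EuclideanSpace ℝ (Fin 2) → ℝ := fun x => fderiv ℝ Gf x (‖x‖⁻¹ • x) with hμ
  set X : Set (EuclideanSpace ℝ (Fin 2)) := {x | |‖x‖ - 1| ≤ δ₃ / 2} with hXdef
  have hXzone : ∀ x ∈ X, |‖x‖ - 1| < δ₂ := fun x hx => by
    have hx' : |‖x‖ - 1| ≤ δ₃ / 2 := hx
    exact lt_of_le_of_lt hx' hδ₃₂'
  have hXc : IsCompact X := by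
    have : X = closedBall (0 : EuclideanSpace ℝ (Fin 2)) (1 + δ₃ / 2) ∩ {x | 1 - δ₃ / 2 ≤ ‖x‖} := by
      ext x
      simp only [hXdef, mem_setOf_eq, mem_inter_iff, mem_closedBall, dist_zero_right, abs_le]
      constructor
      · rintro ⟨h1, h2⟩; exact ⟨by linarith, by linarith⟩
      · rintro ⟨h1, h2⟩; exact ⟨by linarith, by linarith⟩
    rw [this]
    exact (isCompact_closedBall _ _).inter_right (isClosed_le continuous_const continuous_norm)
  have hμc : ContinuousOn μ X := by
    intro x hx
    have hx0 : x ≠ 0 := by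
      intro h; have := hx; rw [hXdef, mem_setOf_eq, h, norm_zero] at this
      have := abs_le.1 this; linarith
    have hopen : IsOpen {x : EuclideanSpace ℝ (Fin 2) | |‖x‖ - 1| < δ₂} :=
      isOpen_lt (continuous_abs.comp (continuous_norm.sub continuous_const)) continuous_const
    have hGfon : ContDiffOn ℝ ∞ Gf {x : EuclideanSpace ℝ (Fin 2) | |‖x‖ - 1| < δ₂} := fun x hx => (hGfat x hx).contDiffWithinAt
    have h1 : ContinuousAt (fun x => fderiv ℝ Gf x) x :=
      (hGfon.continuousOn_fderiv_of_isOpen hopen (by simp)).continuousAt (hopen.mem_nhds (hXzone x hx))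
    have h2 : ContinuousAt (fun x : EuclideanSpace ℝ (Fin 2) => ‖x‖⁻¹ • x) x :=
      (continuous_norm.continuousAt.inv₀ (norm_ne_zero_iff.2 hx0)).smul continuousAt_id
    exact (h1.clm_apply h2).continuousWithinAt
  have hXne : X.Nonempty := ⟨EuclideanSpace.single 0 1, by simp [hXdef]; positivity⟩
  obtain ⟨x₀, hx₀, hmax⟩ := hXc.exists_isMaxOn hXne hμc
  set μ₀ : ℝ := -μ x₀ with hμ₀
  have hμ₀pos : 0 < μ₀ := by have := (hzone x₀ (hXzone x₀ hx₀)).2; simp only [hμ₀, hμ]; linarith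
  have hμle : ∀ x ∈ X, μ x ≤ -μ₀ := fun x hx => by have := hmax hx; simp only [hμ₀, neg_neg]; exact this
  -- the radial level functions `h u r = G(f₁(r u))`
  have hray : ∀ (u : sphere (0 : EuclideanSpace ℝ (Fin 2)) 1) (r : ℝ), |r - 1| < δ₂ →
      |‖r • (u : EuclideanSpace ℝ (Fin 2))‖ - 1| < δ₂ ∧ ‖r • (u : EuclideanSpace ℝ (Fin 2))‖⁻¹ • (r • (u : EuclideanSpace ℝ (Fin 2))) = u := by
    intro u r hr
    have hr0 : 0 < r := by have := (abs_lt.1 hr).1; linarith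
    have hn : ‖r • (u : EuclideanSpace ℝ (Fin 2))‖ = r := by
      rw [norm_smul, norm_eq_of_mem_sphere, mul_one, Real.norm_eq_abs, abs_of_pos hr0]
    refine ⟨by rwa [hn], ?_⟩
    rw [hn, smul_smul, inv_mul_cancel₀ hr0.ne', one_smul]
  have hderiv : ∀ (u : sphere (0 : EuclideanSpace ℝ (Fin 2)) 1) (r : ℝ), |r - 1| < δ₂ →
      HasStrictDerivAt (fun ρ : ℝ => Gf (ρ • (u : EuclideanSpace ℝ (Fin 2))))
        (fderiv ℝ Gf (r • (u : EuclideanSpace ℝ (Fin 2))) (u : EuclideanSpace ℝ (Fin 2))) r := by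
    intro u r hr
    have hsm : ContDiffAt ℝ ∞ (fun ρ : ℝ => Gf (ρ • (u : EuclideanSpace ℝ (Fin 2)))) r :=
      (hGfat _ (hray u r hr).1).comp r (contDiffAt_id.smul contDiffAt_const)
    have hline : HasDerivAt (fun ρ : ℝ => ρ • (u : EuclideanSpace ℝ (Fin 2))) (u : EuclideanSpace ℝ (Fin 2)) r := by
      simpa using (hasDerivAt_id r).smul_const (u : EuclideanSpace ℝ (Fin 2))
    have hG' : HasFDerivAt Gf (fderiv ℝ Gf (r • (u : EuclideanSpace ℝ (Fin 2)))) (r • (u : EuclideanSpace ℝ (Fin 2))) :=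
      ((hGfat (r • (u : EuclideanSpace ℝ (Fin 2))) (hray u r hr).1).differentiableAt (by simp)).hasFDerivAt
    have hd : HasDerivAt (fun ρ : ℝ => Gf (ρ • (u : EuclideanSpace ℝ (Fin 2))))
        (fderiv ℝ Gf (r • (u : EuclideanSpace ℝ (Fin 2))) (u : EuclideanSpace ℝ (Fin 2))) r :=
      hG'.comp_hasDerivAt_of_eq r hline rfl
    have hs := hsm.hasStrictDerivAt (by simp)
    rwa [hd.deriv] at hs
  have hderiv_neg : ∀ (u : sphere (0 : EuclideanSpace ℝ (Fin 2)) 1) (r : ℝ), |r - 1| < δ₂ →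
      fderiv ℝ Gf (r • (u : EuclideanSpace ℝ (Fin 2))) (u : EuclideanSpace ℝ (Fin 2)) < 0 := by
    intro u r hr
    have h := (hzone _ (hray u r hr).1).2
    rwa [(hray u r hr).2] at h
  have hderiv_le : ∀ (u : sphere (0 : EuclideanSpace ℝ (Fin 2)) 1) (r : ℝ), |r - 1| ≤ δ₃ / 2 →
      fderiv ℝ Gf (r • (u : EuclideanSpace ℝ (Fin 2))) (u : EuclideanSpace ℝ (Fin 2)) ≤ -μ₀ := by
    intro u r hr
    have hr' : |r - 1| < δ₂ := lt_of_le_of_lt hr hδ₃₂'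
    have hmem : r • (u : EuclideanSpace ℝ (Fin 2)) ∈ X := by
      show |‖r • (u : EuclideanSpace ℝ (Fin 2))‖ - 1| ≤ δ₃ / 2
      have hr0 : 0 < r := by have := (abs_lt.1 hr').1; linarith
      rwa [norm_smul, norm_eq_of_mem_sphere, mul_one, Real.norm_eq_abs, abs_of_pos hr0]
    have h := hμle _ hmem
    simp only [hμ, (hray u r hr').2] at h
    exact h
  have hone : ∀ u : sphere (0 : EuclideanSpace ℝ (Fin 2)) 1, Gf ((1 : ℝ) • (u : EuclideanSpace ℝ (Fin 2))) = 1 := by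
    intro u
    simp only [hGf, one_smul, hf.apply_sphere u]
    exact (hK.mem u).2
  -- the uniform time window
  refine ⟨μ₀ * (δ₃ / 2), by positivity, fun u s hs => ?_⟩
  set h : ℝ → ℝ := fun ρ => Gf (ρ • (u : EuclideanSpace ℝ (Fin 2))) with hh
  set I : Set ℝ := Ioo (1 - δ₃) (1 + δ₃) with hI
  have hImem : ∀ r ∈ I, |r - 1| < δ₂ := fun r hr => by
    rw [abs_lt]; exact ⟨by linarith [hr.1], by linarith [hr.2, hδ₃₂]⟩
  have hstrict : ∀ r ∈ I, HasStrictDerivAt h (fderiv ℝ Gf (r • (u : EuclideanSpace ℝ (Fin 2))) (u : EuclideanSpace ℝ (Fin 2))) r :=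
    fun r hr => hderiv u r (hImem r hr)
  have hne : ∀ r ∈ I, fderiv ℝ Gf (r • (u : EuclideanSpace ℝ (Fin 2))) (u : EuclideanSpace ℝ (Fin 2)) ≠ 0 :=
    fun r hr => (hderiv_neg u r (hImem r hr)).ne
  have hcont : ContinuousOn h I := fun r hr => (hstrict r hr).hasDerivAt.continuousAt.continuousWithinAt
  -- `h` is strictly decreasing on `I`, hence injective, and open
  have hanti : StrictAntiOn h I := by
    refine strictAntiOn_of_deriv_neg (convex_Ioo _ _) hcont fun r hr => ?_
    rw [interior_Ioo] at hr
    rw [(hstrict r hr).hasDerivAt.deriv]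
    exact hderiv_neg u r (hImem r hr)
  have hinj : InjOn h I := hanti.injOn
  set g : ℝ → ℝ := invFunOn h I with hg
  have hgleft : ∀ r ∈ I, g (h r) = r := fun r hr => hinj.leftInvOn_invFunOn hr
  have hgmem : ∀ y ∈ h '' I, g y ∈ I := fun y hy => invFunOn_mem (by simpa using hy)
  have hgright : ∀ y ∈ h '' I, h (g y) = y := fun y hy => invFunOn_eq (by simpa using hy)
  have hIo : IsOpen (h '' I) := by
    rw [isOpen_iff_mem_nhds]
    rintro _ ⟨r, hr, rfl⟩
    rw [← (hstrict r hr).map_nhds_eq (hne r hr)]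
    exact Filter.image_mem_map (isOpen_Ioo.mem_nhds hr)
  have hgderiv : ∀ y ∈ h '' I, HasDerivAt g (fderiv ℝ Gf (g y • (u : EuclideanSpace ℝ (Fin 2))) (u : EuclideanSpace ℝ (Fin 2)))⁻¹ y := by
    intro y hy
    have hr := hgmem y hy
    have hev : ∀ᶠ x in 𝓝 (g y), g (h x) = x := by
      filter_upwards [isOpen_Ioo.mem_nhds hr] with x hx
      exact hgleft x hx
    have := (hstrict (g y) hr).to_local_left_inverse (hne (g y) hr) hev
    rw [hgright y hy] at this
    exact this.hasDerivAt
  -- the window `|s| < μ₀ δ₃/2` lies in the image of the closed half-annulus (mean value and IVT)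
  have hwindow : ∀ σ : ℝ, |σ| < μ₀ * (δ₃ / 2) → 1 + σ ∈ h '' I := by
    intro σ hσ
    have ha : (1 : ℝ) - δ₃ / 2 ≤ 1 + δ₃ / 2 := by linarith
    have hsubI : Icc (1 - δ₃ / 2) (1 + δ₃ / 2) ⊆ I := fun r hr => ⟨by linarith [hr.1], by linarith [hr.2]⟩
    have hcont' : ContinuousOn h (Icc (1 - δ₃ / 2) (1 + δ₃ / 2)) := hcont.mono hsubI
    have hdiff : DifferentiableOn ℝ h (interior (Icc (1 - δ₃ / 2) (1 + δ₃ / 2))) := fun r hr =>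
      (hstrict r (hsubI (interior_subset hr))).hasDerivAt.differentiableAt.differentiableWithinAt
    have hder' : ∀ r ∈ interior (Icc (1 - δ₃ / 2) (1 + δ₃ / 2)), deriv h r ≤ -μ₀ := by
      intro r hr
      rw [interior_Icc] at hr
      rw [(hstrict r (hsubI (Ioo_subset_Icc_self hr))).hasDerivAt.deriv]
      exact hderiv_le u r (by rw [abs_le]; exact ⟨by linarith [hr.1], by linarith [hr.2]⟩)
    have hmv := (convex_Icc (1 - δ₃ / 2) (1 + δ₃ / 2)).image_sub_le_mul_sub_of_deriv_le hcont' hdiff hder'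
    have h1mem : (1 : ℝ) ∈ Icc (1 - δ₃ / 2) (1 + δ₃ / 2) := ⟨by linarith, by linarith⟩
    have htop := hmv 1 h1mem (1 + δ₃ / 2) (right_mem_Icc.2 ha) (by linarith)
    have hbot := hmv (1 - δ₃ / 2) (left_mem_Icc.2 ha) 1 h1mem (by linarith)
    have h1 : h 1 = 1 := hone u
    rw [h1] at htop hbot
    have hσ' := abs_lt.1 hσ
    have hivt := intermediate_value_Icc' ha hcont'
    have hmem : 1 + σ ∈ Icc (h (1 + δ₃ / 2)) (h (1 - δ₃ / 2)) := ⟨by nlinarith, by nlinarith⟩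
    obtain ⟨r, hr, hrσ⟩ := hivt hmem
    exact ⟨r, hsubI hr, hrσ⟩
  -- the candidate integral curve `σ ↦ f₁(g(1 + σ) u)` on the window
  set J : Set ℝ := Ioo (-(μ₀ * (δ₃ / 2))) (μ₀ * (δ₃ / 2)) with hJ
  have hJw : ∀ σ ∈ J, 1 + σ ∈ h '' I := fun σ hσ => hwindow σ (abs_lt.2 ⟨hσ.1, hσ.2⟩)
  set γ₂ : ℝ → EuclideanSpace ℝ (Fin 4) := fun σ => f₁ (g (1 + σ) • (u : EuclideanSpace ℝ (Fin 2))) with hγ₂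
  have hγ₂d : ∀ σ ∈ J, HasDerivAt γ₂ (V (γ₂ σ)) σ := by
    intro σ hσ
    have hy := hJw σ hσ
    set r := g (1 + σ) with hrdef
    have hrI : r ∈ I := hgmem _ hy
    have hrδ' : 1 - δ' < r ∧ r < 1 + δ' := ⟨by linarith [hrI.1], by linarith [hrI.2]⟩
    -- derivative of `σ ↦ g(1 + σ) • u`
    have hg1 : HasDerivAt (fun σ : ℝ => g (1 + σ))
        (fderiv ℝ Gf (r • (u : EuclideanSpace ℝ (Fin 2))) (u : EuclideanSpace ℝ (Fin 2)))⁻¹ σ := by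
      have h := (hgderiv _ hy).comp σ ((hasDerivAt_id σ).const_add 1)
      rw [mul_one] at h
      exact h
    have hgu : HasDerivAt (fun σ : ℝ => g (1 + σ) • (u : EuclideanSpace ℝ (Fin 2)))
        ((fderiv ℝ Gf (r • (u : EuclideanSpace ℝ (Fin 2))) (u : EuclideanSpace ℝ (Fin 2)))⁻¹ • (u : EuclideanSpace ℝ (Fin 2))) σ :=
      hg1.smul_const _
    have hfd : HasFDerivAt f₁ (fderiv ℝ f₁ (r • (u : EuclideanSpace ℝ (Fin 2)))) (g (1 + σ) • (u : EuclideanSpace ℝ (Fin 2))) :=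
      ((hfs.differentiable (by simp)) _).hasFDerivAt
    have h := hfd.comp_hasDerivAt σ hgu
    rw [map_smul, ← htan u r hrδ'.1 hrδ'.2] at h
    exact h
  -- uniqueness of integral curves
  have hsJ : s ∈ J := by have := abs_lt.1 hs; exact ⟨this.1, this.2⟩
  have h1I : (1 : ℝ) ∈ I := ⟨by linarith, by linarith⟩
  have heq := ODE_solution_unique_of_mem_Ioo (v := fun _ y => V y) (s := fun _ => univ) (K := C)
    (f := fun σ => Φ (σ, f₁ (u : EuclideanSpace ℝ (Fin 2)))) (g := γ₂)
    (a := -(μ₀ * (δ₃ / 2))) (b := μ₀ * (δ₃ / 2)) (t₀ := 0)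
    (fun _ _ => hC.lipschitzOnWith) ⟨by linarith [mul_pos hμ₀pos (half_pos hδ₃pos)], by positivity⟩
    (fun σ _ => ⟨hΦ _ σ, mem_univ _⟩) (fun σ hσ => ⟨hγ₂d σ hσ, mem_univ _⟩)
    (by
      have hg1 : g 1 = 1 := by
        have := hgleft 1 h1I
        rwa [show h 1 = 1 from hone u] at this
      simp [hγ₂, hΦ0, hg1])
  refine ⟨g (1 + s), ?_, heq hsJ, ?_⟩
  · have hrI := hgmem _ (hJw s hsJ)
    rw [abs_lt]; exact ⟨by linarith [hrI.1], by linarith [hrI.2]⟩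
  · exact hgright _ (hJw s hsJ)

end FriendsCarrierVk

open FriendsCarrierVk in
/-- **Helper `helper_friendsCarrier_Vk_discFlowLinesNeat`** (registered piece of `helper_friendsCarrier_Vk`: in the
collar of the neat-adapted field the slice disc is a product, parametrised by level).  For a neat model
slice disc `f₁` of a model knot `K₁`, a `C^∞` field `V` on `ℝ⁴` vanishing outside a ball with
`V(f₁(t u)) = (d(G_k ∘ f₁)(t u) u)⁻¹ • df₁(t u) u` for `|t - 1| < δ'` (the output of
`helper_friendsCarrier_Vk_adaptedFieldNeat`) and any flow `Φ` of `V`, there is `δ'' > 0` such that for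
`|s| < δ''` the flow line from `K₁ u` is on the disc ray through `u` at level `1 + s`:
`Φ(s, K₁ u) = f₁(r u)` with `|r - 1| < δ'` and `G_k(f₁(r u)) = 1 + s`. [folklore] -/
theorem helper_friendsCarrier_Vk_discFlowLinesNeat : ∀ (k : ℕ) (K₁ : (Metric.sphere (0 : EuclideanSpace ℝ (Fin 2)) 1) → EuclideanSpace ℝ (Fin 4)) (f₁ : EuclideanSpace ℝ (Fin 2) → EuclideanSpace ℝ (Fin 4)) (V : EuclideanSpace ℝ (Fin 4) → EuclideanSpace ℝ (Fin 4)) (Φ : ℝ × EuclideanSpace ℝ (Fin 4) → EuclideanSpace ℝ (Fin 4)) (R δ' : ℝ), Literature.Topology.FourManifolds.MMSW.IsModelKnot k K₁ → Literature.Topology.FourManifolds.MMSW.IsModelSliceDisc k K₁ f₁ → (∀ t : (Metric.sphere (0 : EuclideanSpace ℝ (Fin 2)) 1), deriv (fun ρ : ℝ => Literature.Topology.FourManifolds.MMSW.levelFun k (f₁ (ρ • (t : EuclideanSpace ℝ (Fin 2))))) 1 < 0) → ContDiff ℝ ((⊤ : ℕ∞) : WithTop ℕ∞) V → (∀ y,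 R ≤ ‖y‖ → V y = 0) → 0 < δ' → (∀ (u : (Metric.sphere (0 : EuclideanSpace ℝ (Fin 2)) 1)) (t : ℝ), 1 - δ' < t → t < 1 + δ' → V (f₁ (t • (u : EuclideanSpace ℝ (Fin 2)))) = (fderiv ℝ (fun y => Literature.Topology.FourManifolds.MMSW.levelFun k (f₁ y)) (t • (u : EuclideanSpace ℝ (Fin 2))) (u : EuclideanSpace ℝ (Fin 2)))⁻¹ • fderiv ℝ f₁ (t • (u : EuclideanSpace ℝ (Fin 2))) (u : EuclideanSpace ℝ (Fin 2))) → (∀ x s, HasDerivAt (fun s : ℝ => Φ (s, x)) (V (Φ (s, x))) s) → (∀ x, Φ (0, x) = x) → ∃ δ'' : ℝ, 0 < δ'' ∧ ∀ (u : (Metric.sphere (0 : EuclideanSpace ℝ (Fin 2)) 1)) (s : ℝ), |s| < δ'' → ∃ r : ℝ, |r - 1| < δ' ∧ Φ (s, K₁ u) = f₁ (r • (u : EuclideanSpace ℝ (Fin 2))) ∧ Literature.Topology.FourManifolds.MMSW.levelFun k (f₁ (r • (u : EuclideanSpace ℝ (Fin 2)))) = 1 + s := by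
  intro k K₁ f₁ V Φ R δ' hK hf hneat hV hVR hδ' htan hΦ hΦ0
  obtain ⟨δ'', hδ'', h⟩ := flow_eq_disc_ray_neat k hK hf hneat hV hVR hδ' htan hΦ hΦ0
  refine ⟨δ'', hδ'', fun u s hs => ?_⟩
  rw [← hf.apply_sphere u]
  exact h u s hs

end Summit.SmoothPoincare4.SmoothPoincare4.Theorems.DcrGap.MkFriends

end
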